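import Literature.AlgebraicGeometry.Modules.PullbackAffineChart
import Literature.AlgebraicGeometry.Modules.PushforwardTrace
import HarnessLib

/-!
# The trace retraction `Γ(f⁻¹V, f^*M) → Γ(V, M)` on an affine chart: `c · η(m) ↦ Tr_f(c) · m`

Let `f : X → Y` be a morphism of schemes whose direct image `f_*𝒪_X` is a finite locally free `𝒪_Y`-module (`h`; e.g. `f`
finite locally free), so that the trace `Tr_f : f_*𝒪_X → 𝒪_Y` of The Stacks Project, Tag 0BVH is available
(`Modules/PushforwardTrace`: «the composition `𝒪_Y → π_*𝒪_X → 𝒪_Y` equals multiplication by the degree of `π`»), and let `M`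
be an affine-localizing (e.g. quasi-coherent) `𝒪_Y`-module. For `f` AFFINE and an affine open `V ⊆ Y` the sections of `f^*M`
over the affine `f⁻¹V` are `Γ(f⁻¹V, 𝒪_X) ⊗_{Γ(V, 𝒪_Y)} Γ(V, M)` (Görtz–Wedhorn I, Prop. 7.24 (2); the tree's
`Modules/PullbackAffineChart.chartSectionsEquiv`, `c ⊗ m ↦ c · η(m)|`). This file defines and computes the chart-level
**trace retraction**

  `ρ_V : Γ(f⁻¹V, f^*M) = Γ(V, f_*f^*M) ⟶ Γ(V, M)`,  `c · η(m)|_{f⁻¹V} ↦ Tr_V(c) · m`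

(`traceRetractionApp`; the map `1 ⊗ Tr` of the projection formula `f_*f^*M ≅ M ⊗ f_*𝒪_X` read on the chart, WITHOUT the
projection formula):

* `traceSec`, `traceSec_add`, `traceSec_app_mul` — `Tr_V : Γ(f⁻¹V, 𝒪_X) → Γ(V, 𝒪_Y)` and its `Γ(V)`-linearity through `f♯`;
* `traceRetractionApp f h M hV hM` and **`traceRetractionApp_smul_unitSectionLE`**: `ρ_V(c · η(m)|) = Tr_V(c) · m`;
* `pullback_sections_induction` — a property of sections of `Γ(f⁻¹V, f^*M)` stable under `0`, `+` and true on the `c · η(m)|`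
  holds everywhere;
* **`traceRetractionApp_unitSection_of_frame`** — `ρ_V(η(m)) = #I · m` over a chart `V` where `f_*𝒪_X|_V ≅ 𝒪_V^I` is framed
  (`ρ ∘ η = deg f`, Tag 0BVH); `traceRetractionApp_smul` — `ρ_V` is `Γ(V)`-linear; **`traceRetractionApp_map`** — `ρ` is
  compatible with restriction to a smaller affine chart `V' ⊆ V`; **`traceRetractionApp_naturality`** — `ρ` is natural in `M`.

These are the chart data from which the sheaf morphism `ρ_M : f_*f^*M → M` (a retraction of the unit up to the degree) is glued
on the basis of affine opens (sequel). Everything is proved; no named facts, no `sorry`. Written for Hodge road №4 (crux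
stmt-HodgeConjecture-26512, lens line N′, parked input (R) of `Summits/…/Theorems/VHCAbelianSchemesRoadExtJumpLocusLiftsOfRetract`:
bounded vector-bundle complexes on `Y` are retracts of `q_*q^*` along an isogeny `q`).

## References

* The Stacks Project, Tag 0BVH (Discriminants, §49.3: the trace of a finite locally free morphism, `Trace_π ∘ π♯ = deg π`),
  Tag 01I8 (pull-back of quasi-coherent modules on affines). [StacksProject]
* U. Görtz, T. Wedhorn, *Algebraic Geometry I: Schemes*, 2nd ed. (2020), Prop. 7.24 (2), Rem. 7.25. [GortzWedhorn2020]
* R. Hartshorne, *Algebraic Geometry*, GTM 52 (1977), II Prop. 5.2 (e), II Ex. 5.1 (d) (projection formula), IV Ex. 2.6 (trace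
  of a finite flat morphism). [Hartshorne1977]
-/

noncomputable section

-- `TopCat.Presheaf`/`Scheme.Modules` are not reducible (as in Mathlib's `AlgebraicGeometry/Modules/Sheaf.lean`).
set_option backward.isDefEq.respectTransparency false

open CategoryTheory AlgebraicGeometry TopologicalSpace Opposite
open AlgebraicGeometry.Scheme.Modules
open scoped ChangeOfRings

universe u

namespace Literature.AlgebraicGeometry.Modules

open Literature.AlgebraicGeometry.Motives

variable {X Y : Scheme.{u}} (f : X ⟶ Y)
  (h : IsFiniteLocallyFree ((pushforward f).obj (unitModule X)))
  (M : Y.Modules) {V : Y.Opens} (hV : IsAffineOpen V)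

/-- `Γ(f⁻¹V, 𝒪_X)` as a `Γ(V, 𝒪_Y)`-module through `f♯` (the left factor of the chart tensor product). [folklore] -/
abbrev chartRing (V : Y.Opens) : ModuleCat.{u} Γ(Y, V) :=
  (ModuleCat.restrictScalars (chartHom f (le_refl (f ⁻¹ᵁ V))).hom).obj (ModuleCat.of Γ(X, f ⁻¹ᵁ V) Γ(X, f ⁻¹ᵁ V))

/-- A section of `𝒪_X` over `f⁻¹V` read as a section of `f_*𝒪_X` over `V` (the identity; Mathlib `pushforward_obj_obj`). [folklore] -/
abbrev asPushforwardSec (c : Γ(X, f ⁻¹ᵁ V)) : Γ((pushforward f).obj (unitModule X), V) := c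

/-- The chart ring map is `f♯_V` on elements. [folklore] -/
private theorem chartHom_refl_apply (r : Γ(Y, V)) : (chartHom f (le_refl (f ⁻¹ᵁ V))).hom r = (f.app V).hom r :=
  congrArg (fun φ : Γ(Y, V) ⟶ Γ(X, f ⁻¹ᵁ V) => φ.hom r) (Scheme.Hom.appLE_eq_app f)

/-- The `Γ(V)`-action on `Γ(V, f_*𝒪_X) = Γ(f⁻¹V, 𝒪_X)` is multiplication by `f♯_V`. [folklore] -/
private theorem smul_asPushforwardSec (r : Γ(Y, V)) (c : Γ(X, f ⁻¹ᵁ V)) :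
    r • asPushforwardSec f c = asPushforwardSec f ((f.app V).hom r * c) := rfl

/-- The `Γ(V)`-action on the chart ring `Γ(f⁻¹V, 𝒪_X)` is multiplication by the chart map `f♯` (definitional). [folklore] -/
private theorem chartRing_smul (r : Γ(Y, V)) (c : chartRing f V) :
    (r • c : chartRing f V) = (show chartRing f V from ((chartHom f (le_refl (f ⁻¹ᵁ V))).hom r * (show Γ(X, f ⁻¹ᵁ V) from c))) := rfl

/-- A section of the `𝒪_Y`-module `𝒪_Y` read as a ring element (the identity). [folklore] -/
abbrev asRingSec (a : Γ(unitModule Y, V)) : Γ(Y, V) := a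

/-- **`Tr_V(c) ∈ Γ(V, 𝒪_Y)`** for `c ∈ Γ(f⁻¹V, 𝒪_X)`. [cite: StacksProject, Tag 0BVH] -/
def traceSec (c : Γ(X, f ⁻¹ᵁ V)) : Γ(Y, V) :=
  asRingSec ((pushforwardTrace f h).app V (asPushforwardSec f c))

/-- `Tr_V` is additive. [cite: StacksProject, Tag 0BVH] -/
theorem traceSec_add (c c' : Γ(X, f ⁻¹ᵁ V)) : traceSec f h (V := V) (c + c') = traceSec f h c + traceSec f h c' :=
  ((pushforwardTrace f h).app V).hom.map_add _ _

/-- `Tr_V` is `Γ(V)`-linear through `f♯`: `Tr_V(f♯(r) c) = r · Tr_V(c)`. [cite: StacksProject, Tag 0BVH] -/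
theorem traceSec_app_mul (r : Γ(Y, V)) (c : Γ(X, f ⁻¹ᵁ V)) :
    traceSec f h (V := V) ((f.app V).hom r * c) = r * traceSec f h c := by
  change asRingSec ((pushforwardTrace f h).app V (asPushforwardSec f ((f.app V).hom r * c))) = _
  rw [← smul_asPushforwardSec, Scheme.Modules.Hom.app_smul]
  rfl

/-- The bilinear map `(c, p) ↦ Tr_V(c) · p` on `Γ(f⁻¹V, 𝒪_X) × Γ(V, M)` (the second factor in its `Spec`-chart spelling
`restrictTop M hV`). [cite: StacksProject, Tag 0BVH] -/
def traceSmulBilin : chartRing f V →+ (restrictTop M hV →+ Γ(M, V)) :=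
  AddMonoidHom.mk' (fun c => AddMonoidHom.mk'
      (fun p => traceSec f h (V := V) (show Γ(X, f ⁻¹ᵁ V) from c) • (appTopRestrictFromSpecEquiv M hV).symm p)
      (fun p p' => by rw [map_add, smul_add]))
    (fun c c' => by
      ext p
      simp only [AddMonoidHom.mk'_apply, AddMonoidHom.add_apply]
      change traceSec f h (V := V) ((show Γ(X, f ⁻¹ᵁ V) from c) + (show Γ(X, f ⁻¹ᵁ V) from c')) • _ = _
      rw [traceSec_add, add_smul])

/-- `traceSmulBilin` evaluated (definitional). [folklore] -/
private theorem traceSmulBilin_apply (c : chartRing f V) (p : restrictTop M hV) :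
    traceSmulBilin f h M hV c p = traceSec f h (V := V) (show Γ(X, f ⁻¹ᵁ V) from c) • (appTopRestrictFromSpecEquiv M hV).symm p :=
  rfl

/-- Balance of `traceSmulBilin` over `Γ(V)`: `Tr(f♯(r) c) · p = Tr(c) · (r p)`. [folklore] -/
private theorem traceSmulBilin_smul (r : Γ(Y, V)) (c : chartRing f V) (p : restrictTop M hV) :
    traceSmulBilin f h M hV (r • c) p = traceSmulBilin f h M hV c (r • p) := by
  rw [traceSmulBilin_apply, traceSmulBilin_apply, LinearEquiv.map_smul, smul_smul]
  change traceSec f h (V := V) ((chartHom f (le_refl (f ⁻¹ᵁ V))).hom r * (show Γ(X, f ⁻¹ᵁ V) from c)) • _ = _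
  rw [chartHom_refl_apply, traceSec_app_mul, mul_comm]

/-- **The trace retraction on the affine chart `V`**: `ρ_V : Γ(f⁻¹V, f^*M) → Γ(V, M)`, `c · η(m)| ↦ Tr_V(c) · m`, i.e. the composite
`Γ(f⁻¹V, f^*M) ≃ Γ(f⁻¹V, 𝒪_X) ⊗_{Γ(V)} Γ(V, M) → Γ(V, M)` (`chartSectionsEquiv`, then `c ⊗ m ↦ Tr_V(c) m`).
[cite: StacksProject, Tag 0BVH] [cite: GortzWedhorn2020, Prop. 7.24 (2)] -/
def traceRetractionApp [IsAffineHom f] (hM : IsAffineLocalizing M) :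
    Γ((pullback f).obj M, f ⁻¹ᵁ V) →+ Γ(M, V) :=
  (TensorProduct.liftAddHom (traceSmulBilin f h M hV) (traceSmulBilin_smul f h M hV)).comp
    (chartSectionsEquiv f M hV (hV.preimage f) (le_refl (f ⁻¹ᵁ V)) hM).symm.toAddMonoidHom

/-- **`ρ_V(c · η(m)|_{f⁻¹V}) = Tr_V(c) · m`.** [cite: StacksProject, Tag 0BVH] -/
theorem traceRetractionApp_smul_unitSectionLE [IsAffineHom f] (hM : IsAffineLocalizing M) (c : Γ(X, f ⁻¹ᵁ V)) (m : Γ(M, V)) :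
    traceRetractionApp f h M hV hM (c • unitSectionLE f M (le_refl (f ⁻¹ᵁ V)) m) = traceSec f h (V := V) c • m := by
  -- the chart coordinates of `c • η(m)|`: the pure tensor `c ⊗ m`
  have h0 : (c • ((1 : Γ(X, f ⁻¹ᵁ V)) ⊗ₜ[Γ(Y, V), (chartHom f (le_refl (f ⁻¹ᵁ V))).hom]
      (appTopRestrictFromSpecEquiv M hV m)) : chartTensor f M hV (le_refl (f ⁻¹ᵁ V))) =
      ((c * 1) ⊗ₜ[Γ(Y, V), (chartHom f (le_refl (f ⁻¹ᵁ V))).hom] (appTopRestrictFromSpecEquiv M hV m) :) := rfl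
  rw [mul_one] at h0
  have h1 : chartSectionsEquiv f M hV (hV.preimage f) (le_refl (f ⁻¹ᵁ V)) hM
      ((c ⊗ₜ[Γ(Y, V), (chartHom f (le_refl (f ⁻¹ᵁ V))).hom] (appTopRestrictFromSpecEquiv M hV m) :) : _) =
      c • unitSectionLE f M (le_refl (f ⁻¹ᵁ V)) m := by
    rw [← h0, chartSectionsEquiv_smul, chartSectionsEquiv_one_tmul]
  change TensorProduct.liftAddHom (traceSmulBilin f h M hV) (traceSmulBilin_smul f h M hV)
    ((chartSectionsEquiv f M hV (hV.preimage f) (le_refl (f ⁻¹ᵁ V)) hM).symm (c • unitSectionLE f M (le_refl (f ⁻¹ᵁ V)) m)) = _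
  rw [← h1, AddEquiv.symm_apply_apply]
  erw [TensorProduct.liftAddHom_tmul]
  rw [traceSmulBilin_apply]
  change traceSec f h (V := V) c • (appTopRestrictFromSpecEquiv M hV).symm (appTopRestrictFromSpecEquiv M hV m) = _
  rw [LinearEquiv.symm_apply_apply]

/-- Mathlib's anonymous pure tensor `t ⊗ₜ n ∈ (extendScalars ψ).obj N` (left factor typed in `(restrictScalars ψ).obj (of T T)`, as
produced by `TensorProduct.induction_on`) is the `ChangeOfRings` pure tensor `t ⊗ₜ[R,ψ] n` of the chart lemmas (same term, two
elaborations; cf. `Modules/PullbackPushforwardGaloisChart`). [folklore] -/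
private theorem extendScalars_tmul_eq_notation {R T : Type u} [CommRing R] [CommRing T] (ψ : R →+* T) {N : ModuleCat.{u} R}
    (t : T) (n : N) :
    (t ⊗ₜ[R] n : (ModuleCat.extendScalars.{u, u, u} ψ).obj N) = ((t ⊗ₜ[R,ψ] n :) : _) := rfl

include hV in
/-- **Induction on sections of `f^*M` over the affine chart**: a property of sections of `Γ(f⁻¹V, f^*M)` stable under `0` and `+` and
true on the sections `c · η(m)|` holds everywhere (`Γ(f⁻¹V, f^*M) = Γ(f⁻¹V, 𝒪) ⊗ Γ(V, M)` is spanned by the pure tensors).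
[cite: GortzWedhorn2020, Prop. 7.24 (2)] -/
theorem pullback_sections_induction [IsAffineHom f] (hM : IsAffineLocalizing M)
    {P : Γ((pullback f).obj M, f ⁻¹ᵁ V) → Prop} (h0 : P 0) (hadd : ∀ s t, P s → P t → P (s + t))
    (hgen : ∀ (c : Γ(X, f ⁻¹ᵁ V)) (m : Γ(M, V)), P (c • unitSectionLE f M (le_refl (f ⁻¹ᵁ V)) m))
    (s : Γ((pullback f).obj M, f ⁻¹ᵁ V)) : P s := by
  set E := chartSectionsEquiv f M hV (hV.preimage f) (le_refl (f ⁻¹ᵁ V)) hM with hE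
  obtain ⟨z, rfl⟩ := E.surjective s
  induction z using TensorProduct.induction_on with
  | zero => rw [map_zero]; exact h0
  | add x y hx hy => rw [map_add]; exact hadd _ _ hx hy
  | tmul c p =>
    obtain ⟨m, rfl⟩ := (appTopRestrictFromSpecEquiv M hV).surjective p
    rw [extendScalars_tmul_eq_notation (chartHom f (le_refl (f ⁻¹ᵁ V))).hom (N := restrictTop M hV) c
      (appTopRestrictFromSpecEquiv M hV m)]
    have h0' : ((show Γ(X, f ⁻¹ᵁ V) from c) • ((1 : Γ(X, f ⁻¹ᵁ V)) ⊗ₜ[Γ(Y, V), (chartHom f (le_refl (f ⁻¹ᵁ V))).hom]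
        (appTopRestrictFromSpecEquiv M hV m)) : chartTensor f M hV (le_refl (f ⁻¹ᵁ V))) =
        (((show Γ(X, f ⁻¹ᵁ V) from c) * 1) ⊗ₜ[Γ(Y, V), (chartHom f (le_refl (f ⁻¹ᵁ V))).hom]
          (appTopRestrictFromSpecEquiv M hV m) :) := rfl
    rw [mul_one] at h0'
    rw [← h0', hE, chartSectionsEquiv_smul, chartSectionsEquiv_one_tmul]
    exact hgen (show Γ(X, f ⁻¹ᵁ V) from c) m

/-- `η(m)|_{f⁻¹V}` along the identity inclusion is `η(m)`. [cite: Hartshorne1977, II.5 (p. 110)] -/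
theorem unitSectionLE_refl (m : Γ(M, V)) : unitSectionLE f M (le_refl (f ⁻¹ᵁ V)) m = unitSection f M V m := by
  unfold unitSectionLE
  rw [presheaf_map_congr _ (homOfLE (le_refl (f ⁻¹ᵁ V))) (𝟙 _), op_id, CategoryTheory.Functor.map_id]
  exact rfl

/-- **`ρ_V(η(m)) = Tr_V(1) · m`.** [cite: StacksProject, Tag 0BVH] -/
theorem traceRetractionApp_unitSection [IsAffineHom f] (hM : IsAffineLocalizing M) (m : Γ(M, V)) :
    traceRetractionApp f h M hV hM (unitSection f M V m) = traceSec f h (V := V) 1 • m := by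
  rw [← unitSectionLE_refl, ← one_smul Γ(X, f ⁻¹ᵁ V) (unitSectionLE f M (le_refl (f ⁻¹ᵁ V)) m),
    traceRetractionApp_smul_unitSectionLE]

/-- **`Tr_V(1) = #I`** over an open `V` where `f_*𝒪_X|_V ≅ 𝒪_V^I` is framed (the local degree of `f`). [cite: StacksProject, Tag 0BVH] -/
theorem traceSec_one {I : Type u} [Fintype I] (e : SheafOfModules.free I ≅ ((pushforward f).obj (unitModule X)).over V) :
    traceSec f h (V := V) 1 = (Fintype.card I : Γ(Y, V)) := by
  have h1 : (1 : Γ(X, f ⁻¹ᵁ V)) = (algebraUnit f).app V (1 : Γ(Y, V)) := by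
    rw [algebraUnit_app_apply, map_one]
  change asRingSec ((pushforwardTrace f h).app V (asPushforwardSec f 1)) = _
  rw [asPushforwardSec, h1, pushforwardTrace_app_algebraUnit f h e, mul_one]

/-- **`ρ_V ∘ η = deg · id` on a framed chart**: `ρ_V(η(m)) = #I · m`. [cite: StacksProject, Tag 0BVH] -/
theorem traceRetractionApp_unitSection_of_frame [IsAffineHom f] (hM : IsAffineLocalizing M) {I : Type u} [Fintype I]
    (e : SheafOfModules.free I ≅ ((pushforward f).obj (unitModule X)).over V) (m : Γ(M, V)) :
    traceRetractionApp f h M hV hM (unitSection f M V m) = (Fintype.card I : Γ(Y, V)) • m := by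
  rw [traceRetractionApp_unitSection, traceSec_one f h e]

/-- **`ρ_V` is `Γ(V, 𝒪_Y)`-linear** (for the `Γ(V)`-action on `Γ(V, f_*f^*M) = Γ(f⁻¹V, f^*M)` through `f♯`).
[cite: StacksProject, Tag 0BVH] -/
theorem traceRetractionApp_smul [IsAffineHom f] (hM : IsAffineLocalizing M) (r : Γ(Y, V)) (s : Γ((pullback f).obj M, f ⁻¹ᵁ V)) :
    traceRetractionApp f h M hV hM ((f.app V).hom r • s) = r • traceRetractionApp f h M hV hM s := by
  induction s using pullback_sections_induction f M hV hM with
  | h0 => rw [smul_zero, map_zero, smul_zero]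
  | hadd s t hs ht => rw [smul_add, map_add, map_add, smul_add, hs, ht]
  | hgen c m => rw [smul_smul, traceRetractionApp_smul_unitSectionLE, traceRetractionApp_smul_unitSectionLE, traceSec_app_mul,
      mul_smul]

/-- Restricting `η(m)|_{f⁻¹V}` to `f⁻¹V'` gives `η(m|_{V'})|_{f⁻¹V'}`. [cite: Hartshorne1977, II.5 (p. 110)] -/
theorem map_unitSectionLE_refl {V' : Y.Opens} (k : V' ⟶ V) (m : Γ(M, V)) :
    ((pullback f).obj M).presheaf.map ((Opens.map f.base).map k).op (unitSectionLE f M (le_refl (f ⁻¹ᵁ V)) m) =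
      unitSectionLE f M (le_refl (f ⁻¹ᵁ V')) (M.presheaf.map k.op m) := by
  rw [unitSectionLE_refl, unitSectionLE_refl, unitSection_map]

/-- **`ρ` is compatible with restriction to a smaller affine chart**: for affine `V' ⊆ V`, `ρ_{V'}(s|_{f⁻¹V'}) = ρ_V(s)|_{V'}`.
[cite: StacksProject, Tag 0BVH] -/
theorem traceRetractionApp_map [IsAffineHom f] (hM : IsAffineLocalizing M) {V' : Y.Opens} (hV' : IsAffineOpen V') (k : V' ⟶ V)
    (s : Γ((pullback f).obj M, f ⁻¹ᵁ V)) :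
    traceRetractionApp f h M hV' hM (((pullback f).obj M).presheaf.map ((Opens.map f.base).map k).op s) =
      M.presheaf.map k.op (traceRetractionApp f h M hV hM s) := by
  induction s using pullback_sections_induction f M hV hM with
  | h0 => simp only [map_zero]
  | hadd s t hs ht => simp only [map_add, hs, ht]
  | hgen c m =>
    rw [Scheme.Modules.map_smul, map_unitSectionLE_refl, traceRetractionApp_smul_unitSectionLE,
      traceRetractionApp_smul_unitSectionLE, Scheme.Modules.map_smul]
    congr 1
    -- `Tr` commutes with restriction
    change asRingSec ((pushforwardTrace f h).app V' (asPushforwardSec f (X.presheaf.map ((Opens.map f.base).map k).op c))) =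
      Y.presheaf.map k.op (asRingSec ((pushforwardTrace f h).app V (asPushforwardSec f c)))
    have := Scheme.Modules.Hom.app_map_apply (pushforwardTrace f h) k (asPushforwardSec f c)
    exact this

/-- **`ρ` is natural in `M`**: for `φ : M → N` (both affine-localizing), `ρ^N_V(f^*φ(s)) = φ(ρ^M_V(s))`. [cite: StacksProject, Tag 0BVH] -/
theorem traceRetractionApp_naturality [IsAffineHom f] {N : Y.Modules} (hM : IsAffineLocalizing M) (hN : IsAffineLocalizing N)
    (φ : M ⟶ N) (s : Γ((pullback f).obj M, f ⁻¹ᵁ V)) :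
    traceRetractionApp f h N hV hN (((pullback f).map φ).app (f ⁻¹ᵁ V) s) =
      φ.app V (traceRetractionApp f h M hV hM s) := by
  induction s using pullback_sections_induction f M hV hM with
  | h0 => simp only [map_zero]
  | hadd s t hs ht => simp only [map_add, hs, ht]
  | hgen c m =>
    rw [traceRetractionApp_smul_unitSectionLE, Scheme.Modules.Hom.app_smul (φ := φ), Scheme.Modules.Hom.app_smul,
      unitSectionLE_refl, pullback_map_app_unitSection, ← unitSectionLE_refl f N (φ.app V m),
      traceRetractionApp_smul_unitSectionLE]

end Literature.AlgebraicGeometry.Modules
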